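import Summits.QuantumAdvantage.QuantumAdvantage.Theorems.PairFreezingB

/-! # PairFreezingC — part 3/8 (mechanical split for landing of `PairFreezing`; content verbatim; scopes re-opened with their variables) -/

set_option linter.dupNamespace false -- D-0017: single-problem summit ⇒ `QuantumAdvantage.QuantumAdvantage` by design
noncomputable section

namespace Summit.QuantumAdvantage.QuantumAdvantage.Theorems.PairFreezing
open Classical Finset Summit.QuantumAdvantage.AdviceFreeQNC0
open Literature.Computability.MetaComplexity Literature.Computability.MetaComplexity.Smolensky
open Literature.Computability.Complexity (parityFn)
open Summit.QuantumAdvantage.QuantumAdvantage.Theses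
open Summit.QuantumAdvantage.AdviceFreeQNC0.TransferWalk (wtPrefix_zero)
variable {n : ℕ}

namespace Pairing
variable (π : Pairing n)

section Core
variable (c : ℕ) (tab : Fin (n + 1) → Bool)


/-- **per-class Smolensky bound.**  On a class with `m ≥ 1` free bits, the low-degree set `U = {g = true}` meets the
winning inputs at most as often as the losing ones, up to `D·C(m, m/2)`: the class is a cube `{0,1}^m` on which `U`
is a degree-`D` `𝔽_p` level set (`g ∘ e_r`) and the win bit is `W(r) ⊕ PARITY`. -/
theorem class_bound {p : ℕ} [Fact p.Prime] (h2 : (2 : ZMod p) ≠ 0) {D : ℕ} {g : (Fin n → Bool) → Bool}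
    (hg : HasDegF p g D) (r : Fin n → Bool) (hm : 1 ≤ π.m c tab r) :
    (univ.filter fun z => (g (π.e c tab r z) && ringWinU c (fun h _ => tab h) (π.e c tab r z)) = true).card ≤
      (univ.filter fun z => (g (π.e c tab r z) && !ringWinU c (fun h _ => tab h) (π.e c tab r z)) = true).card
        + D * (π.m c tab r).choose (π.m c tab r / 2) := by
  set W : (Fin n → Bool) → Bool := ringWinU c (fun h _ => tab h) with hWdef
  set E := π.e c tab r with hE
  -- the coordinates of the class are affine in the free bits
  have hcoord : ∀ j : Fin n,
      (fun z : Fin (π.m c tab r) → Bool => if E z j = true then (1 : ZMod p) else 0) ∈ lowDeg (ZMod p) (π.m c tab r) 1 := by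
    intro j
    by_cases hfree : ∃ k, j = π.fst (π.emb c tab r k) ∨ j = π.snd (π.emb c tab r k)
    · obtain ⟨k, hk⟩ := hfree
      have hval : ∀ z, E z j = xor (r j) (z k) := by
        intro z
        rcases hk with rfl | rfl
        · exact π.e_fst c tab r z k
        · exact π.e_snd c tab r z k
      have hmono : mono (ZMod p) ({k} : Finset (Fin (π.m c tab r))) =
          fun z => if z k = true then (1 : ZMod p) else 0 := by
        funext z; unfold mono; rw [prod_singleton]
      cases hrj : r j
      · have : (fun z : Fin (π.m c tab r) → Bool => if E z j = true then (1 : ZMod p) else 0) = mono (ZMod p) {k} := by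
          rw [hmono]; funext z; rw [hval z, hrj, Bool.false_xor]
        rw [this]
        exact mono_mem_lowDeg (by rw [card_singleton])
      · have : (fun z : Fin (π.m c tab r) → Bool => if E z j = true then (1 : ZMod p) else 0) =
            1 - mono (ZMod p) {k} := by
          rw [hmono]; funext z; rw [hval z, hrj, Bool.true_xor]
          simp only [Pi.sub_apply, Pi.one_apply]
          cases z k <;> simp
        rw [this]
        exact (lowDeg (ZMod p) (π.m c tab r) 1).sub_mem (one_mem_lowDeg 1) (mono_mem_lowDeg (by rw [card_singleton]))
    · push Not at hfree
      have hval : ∀ z, E z j = r j := fun z => π.e_of_not_free c tab r z j fun k => hfree k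
      cases hrj : r j
      · have : (fun z : Fin (π.m c tab r) → Bool => if E z j = true then (1 : ZMod p) else 0) = 0 := by
          funext z; rw [hval z, hrj]; simp
        rw [this]; exact (lowDeg (ZMod p) (π.m c tab r) 1).zero_mem
      · have : (fun z : Fin (π.m c tab r) → Bool => if E z j = true then (1 : ZMod p) else 0) = 1 := by
          funext z; rw [hval z, hrj]; simp
        rw [this]; exact one_mem_lowDeg 1
  have hQ : (fun z : Fin (π.m c tab r) → Bool => if g (E z) = true then (1 : ZMod p) else 0) ∈
      lowDeg (ZMod p) (π.m c tab r) D :=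
    Smolensky.comp_mem_lowDeg_of_coord E hcoord hg
  have hW : ∀ z, W (E z) = xor (W r) (parityFn (π.m c tab r) z) := π.ringWinU_e c tab r
  -- Smolensky: agreement of `U` with the win bit (or its complement) is at most half plus the error
  have hS : (univ.filter fun z : Fin (π.m c tab r) → Bool =>
      ((g (E z) && W (E z)) || (!g (E z) && !W (E z))) = true).card ≤
      2 ^ (π.m c tab r - 1) + D * (π.m c tab r).choose (π.m c tab r / 2) := by
    cases hb : W r
    · refine le_trans (le_of_eq (congrArg Finset.card (Finset.ext fun z => ?_))) (parity_agreement_le' h2 hQ)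
      simp only [mem_filter, mem_univ, true_and]
      rw [hW z, hb, Bool.false_xor]
      cases g (E z) <;> cases parityFn (π.m c tab r) z <;> simp
    · have h1Q : (1 - fun z : Fin (π.m c tab r) → Bool => if g (E z) = true then (1 : ZMod p) else 0) ∈
          lowDeg (ZMod p) (π.m c tab r) D :=
        (lowDeg (ZMod p) (π.m c tab r) D).sub_mem (one_mem_lowDeg D) hQ
      refine le_trans (le_of_eq (congrArg Finset.card (Finset.ext fun z => ?_))) (parity_agreement_le' h2 h1Q)
      simp only [mem_filter, mem_univ, true_and, Pi.sub_apply, Pi.one_apply]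
      rw [hW z, hb, Bool.true_xor]
      cases g (E z) <;> cases parityFn (π.m c tab r) z <;> simp
  -- the losing inputs of the class form a parity class: exactly half
  have hL : (univ.filter fun z : Fin (π.m c tab r) → Bool => (!W (E z)) = true).card = 2 ^ (π.m c tab r - 1) := by
    rw [← card_filter_parityFn (π.m c tab r) hm (W r)]
    refine congrArg Finset.card (Finset.filter_congr fun z _ => ?_)
    rw [hW z]
    cases W r <;> cases parityFn (π.m c tab r) z <;> simp
  -- bookkeeping
  have hXZ : (univ.filter fun z : Fin (π.m c tab r) → Bool =>
      ((g (E z) && W (E z)) || (!g (E z) && !W (E z))) = true).card =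
      (univ.filter fun z : Fin (π.m c tab r) → Bool => (g (E z) && W (E z)) = true).card +
      (univ.filter fun z : Fin (π.m c tab r) → Bool => (!g (E z) && !W (E z)) = true).card := by
    rw [← card_union_of_disjoint]
    · refine congrArg Finset.card ?_
      ext z
      simp only [mem_union, mem_filter, mem_univ, true_and]
      cases g (E z) <;> cases W (E z) <;> simp
    · refine disjoint_filter.2 fun z _ h1 h2 => ?_
      revert h1 h2
      cases g (E z) <;> cases W (E z) <;> simp
  have hYZ : (univ.filter fun z : Fin (π.m c tab r) → Bool => (!W (E z)) = true).card =
      (univ.filter fun z : Fin (π.m c tab r) → Bool => (g (E z) && !W (E z)) = true).card +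
      (univ.filter fun z : Fin (π.m c tab r) → Bool => (!g (E z) && !W (E z)) = true).card := by
    rw [← card_union_of_disjoint]
    · refine congrArg Finset.card ?_
      ext z
      simp only [mem_union, mem_filter, mem_univ, true_and]
      cases g (E z) <;> cases W (E z) <;> simp
    · refine disjoint_filter.2 fun z _ h1 h2 => ?_
      revert h1 h2
      cases g (E z) <;> cases W (E z) <;> simp
  omega

/-- **THE DETERMINISTIC CORE INEQUALITY (pair freezing + Smolensky).**  For every fixed table, every pairing and
every degree-`D` `𝔽_p` level set `U`:  `#(U ∩ WIN) ≤ #(U ∖ WIN) + (D/√M)·2ⁿ + #{u : fewer than M relevant free pairs}`. -/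
theorem core {p : ℕ} [Fact p.Prime] (h2 : (2 : ZMod p) ≠ 0) {D : ℕ} {g : (Fin n → Bool) → Bool}
    (hg : HasDegF p g D) {M : ℕ} (hM : 1 ≤ M) :
    ((univ.filter fun u => (g u && ringWinU c (fun h _ => tab h) u) = true).card : ℝ) ≤
      (univ.filter fun u => (g u && !ringWinU c (fun h _ => tab h) u) = true).card
        + (D / Real.sqrt M) * 2 ^ n + (univ.filter fun u => decide ((π.rel c tab u).card < M) = true).card := by
  set W : (Fin n → Bool) → Bool := ringWinU c (fun h _ => tab h) with hWdef
  set Reps := (univ : Finset (Fin n → Bool)).image (π.rep c tab) with hReps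
  have hRep : ∀ r ∈ Reps, π.rep c tab r = r := by
    intro r hr
    rw [hReps, mem_image] at hr
    obtain ⟨u, _, rfl⟩ := hr
    exact π.rep_rep c tab u
  have fib : ∀ A : (Fin n → Bool) → Bool, ((univ.filter fun u => A u = true).card : ℝ) =
      ∑ r ∈ Reps, ((univ.filter fun u => A u = true ∧ π.rep c tab u = r).card : ℝ) := by
    intro A
    rw [card_eq_sum_card_fiberwise (f := π.rep c tab) (t := Reps)
      (fun u _ => mem_image_of_mem _ (mem_univ u)), Nat.cast_sum]
    refine sum_congr rfl fun r _ => ?_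
    rw [filter_filter]
  have fibU : ((2 : ℝ) ^ n) = ∑ r ∈ Reps, ((univ.filter fun u => π.rep c tab u = r).card : ℝ) := by
    have h := card_eq_sum_card_fiberwise (f := π.rep c tab) (s := (univ : Finset (Fin n → Bool))) (t := Reps)
      (fun u _ => mem_image_of_mem _ (mem_univ u))
    rw [card_univ, Fintype.card_fun, Fintype.card_bool, Fintype.card_fin] at h
    have h' := congrArg (fun x : ℕ => (x : ℝ)) h
    simp only [Nat.cast_pow, Nat.cast_ofNat, Nat.cast_sum] at h'
    exact h'
  -- per-class inequality
  have hcls : ∀ r ∈ Reps,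
      ((univ.filter fun u => (g u && W u) = true ∧ π.rep c tab u = r).card : ℝ) ≤
        (univ.filter fun u => (g u && !W u) = true ∧ π.rep c tab u = r).card
        + (D / Real.sqrt M) * (univ.filter fun u => π.rep c tab u = r).card
        + (univ.filter fun u => decide ((π.rel c tab u).card < M) = true ∧ π.rep c tab u = r).card := by
    intro r hr
    have hr' := hRep r hr
    have hDM : (0 : ℝ) ≤ D / Real.sqrt M := div_nonneg (Nat.cast_nonneg _) (Real.sqrt_nonneg _)
    by_cases hbig : M ≤ π.m c tab r
    · have hm1 : 1 ≤ π.m c tab r := hM.trans hbig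
      rw [π.card_filter_class c tab hr' (fun u => g u && W u),
        π.card_filter_class c tab hr' (fun u => g u && !W u), π.card_class c tab hr']
      have hcb := π.class_bound c tab h2 hg r hm1
      have hchoose : ((π.m c tab r).choose (π.m c tab r / 2) : ℝ) ≤
          2 ^ (π.m c tab r) / Real.sqrt (π.m c tab r) := by
        have h := BlockParity.choose_half_mul_pow_le hm1 le_rfl
        rwa [Nat.sub_self, pow_zero, mul_one] at h
      have hsqrt : Real.sqrt M ≤ Real.sqrt (π.m c tab r) := Real.sqrt_le_sqrt (by exact_mod_cast hbig)
      have hMpos : (0 : ℝ) < Real.sqrt M := Real.sqrt_pos.2 (by exact_mod_cast hM)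
      have herr : (D : ℝ) * (π.m c tab r).choose (π.m c tab r / 2) ≤
          D / Real.sqrt M * (2 : ℝ) ^ (π.m c tab r) := by
        calc (D : ℝ) * (π.m c tab r).choose (π.m c tab r / 2)
            ≤ D * (2 ^ (π.m c tab r) / Real.sqrt (π.m c tab r)) :=
              mul_le_mul_of_nonneg_left hchoose (Nat.cast_nonneg _)
          _ ≤ D * (2 ^ (π.m c tab r) / Real.sqrt M) := by
              refine mul_le_mul_of_nonneg_left ?_ (Nat.cast_nonneg _)
              exact div_le_div_of_nonneg_left (by positivity) hMpos hsqrt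
          _ = D / Real.sqrt M * 2 ^ (π.m c tab r) := by ring
      have hcb' : ((univ.filter fun z => (g (π.e c tab r z) && W (π.e c tab r z)) = true).card : ℝ) ≤
          (univ.filter fun z => (g (π.e c tab r z) && !W (π.e c tab r z)) = true).card
          + (D : ℝ) * (π.m c tab r).choose (π.m c tab r / 2) := by exact_mod_cast hcb
      have hS0 : (0 : ℝ) ≤
          (univ.filter fun u => decide ((π.rel c tab u).card < M) = true ∧ π.rep c tab u = r).card :=
        Nat.cast_nonneg _
      push_cast
      linarith
    · -- a small class lies entirely inside `{#rel < M}`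
      rw [not_le] at hbig
      have hsub : (univ.filter fun u => (g u && W u) = true ∧ π.rep c tab u = r) ⊆
          (univ.filter fun u => decide ((π.rel c tab u).card < M) = true ∧ π.rep c tab u = r) := by
        intro u hu
        rw [mem_filter] at hu ⊢
        refine ⟨mem_univ _, ?_, hu.2.2⟩
        have : π.rel c tab u = π.rel c tab r := by rw [← hu.2.2, rel_rep]
        rw [this, decide_eq_true_eq]; exact hbig
      have h1 : ((univ.filter fun u => (g u && W u) = true ∧ π.rep c tab u = r).card : ℝ) ≤
          (univ.filter fun u => decide ((π.rel c tab u).card < M) = true ∧ π.rep c tab u = r).card := by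
        exact_mod_cast card_le_card hsub
      have h0 : (0 : ℝ) ≤ (univ.filter fun u => (g u && !W u) = true ∧ π.rep c tab u = r).card :=
        Nat.cast_nonneg _
      have h0' : (0 : ℝ) ≤ D / Real.sqrt M * (univ.filter fun u => π.rep c tab u = r).card :=
        mul_nonneg hDM (Nat.cast_nonneg _)
      linarith
  rw [fib (fun u => g u && W u), fib (fun u => g u && !W u),
    fib (fun u => decide ((π.rel c tab u).card < M)), fibU, mul_sum, ← sum_add_distrib, ← sum_add_distrib]
  exact sum_le_sum hcls

/-- the core inequality in the form used downstream: `#(U ∩ WIN) ≤ ½·#U + ½·(D/√M)·2ⁿ + ½·#{#Rel < M}`. -/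
theorem core_half {p : ℕ} [Fact p.Prime] (h2 : (2 : ZMod p) ≠ 0) {D : ℕ} {g : (Fin n → Bool) → Bool}
    (hg : HasDegF p g D) {M : ℕ} (hM : 1 ≤ M) :
    ((univ.filter fun u => (g u && ringWinU c (fun h _ => tab h) u) = true).card : ℝ) ≤
      (1 / 2) * (univ.filter fun u => g u = true).card
        + (1 / 2) * ((D / Real.sqrt M) * 2 ^ n)
        + (1 / 2) * (univ.filter fun u => decide ((π.rel c tab u).card < M) = true).card := by
  have h := π.core c tab h2 hg hM
  have hsplit : ((univ.filter fun u => g u = true).card : ℝ) =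
      (univ.filter fun u => (g u && ringWinU c (fun h _ => tab h) u) = true).card
      + (univ.filter fun u => (g u && !ringWinU c (fun h _ => tab h) u) = true).card := by
    rw [← Nat.cast_add, ← card_union_of_disjoint]
    · refine congrArg _ (congrArg Finset.card ?_)
      ext u
      simp only [mem_union, mem_filter, mem_univ, true_and]
      cases g u <;> cases ringWinU c (fun h _ => tab h) u <;> simp
    · refine disjoint_filter.2 fun u _ h1 h2 => ?_
      revert h1 h2
      cases g u <;> cases ringWinU c (fun h _ => tab h) u <;> simp
  linarith

end Core


/-! ### §4 The occupation bound: few inputs have few relevant free pairs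

`#{u : #Rel(u) < M} ≤ 3·2^M·(7/8)^K·2ⁿ`, `K = ⌊t/2⌋`, `t` = number of pairs whose middle cut the table fires.  Proof: fix the
weight residue `b` (union bound, factor 3) so that relevance becomes PREFIX-DETERMINED; group the special pairs into consecutive
COUPLES; given all earlier bits, at least 4 of the 16 settings of a couple's bits make one of its two pairs relevant (if the first
pair's residue is bad, the first pair's bits shift the second pair's residue); the potential `Σ_u 2^{#bad couples}` therefore grows
by at most `28/16` per couple. -/

section Occupation

variable (tab : Fin (n + 1) → Bool)

/-- additive form of prefix-weight comparison: points agreeing on `[g₀, g)` have prefix weights differing by a constant. -/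
theorem _root_.Summit.QuantumAdvantage.QuantumAdvantage.Theorems.PairFreezing.wtPrefix_add_congr (u u' : Fin n → Bool)
    (g₀ g : ℕ) (hle : g₀ ≤ g) (hg : g ≤ n) (heq : ∀ j : Fin n, g₀ ≤ j.val → j.val < g → u' j = u j) :
    wtPrefix u' g + wtPrefix u g₀ = wtPrefix u g + wtPrefix u' g₀ := by
  induction g, hle using Nat.le_induction with
  | base => exact Nat.add_comm _ _
  | succ g hg₀ ih =>
    have hgn : g < n := by omega
    rw [wtPrefix_succ u' hgn, wtPrefix_succ u hgn, heq ⟨g, hgn⟩ hg₀ (Nat.lt_succ_self g)]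
    have := ih (by omega) fun j h1 h2 => heq j h1 (by omega)
    omega

/-- prefix-determined relevance for a fixed weight residue `b`. -/
def relB (b : ℕ) (u : Fin n → Bool) : Finset (Fin π.P) :=
  univ.filter fun i => tab (π.mid i) = true ∧ u (π.fst i) ≠ u (π.snd i) ∧
    (b + 2 * i.val + wtPrefix u (π.o + 2 * i.val)) % 3 ≠ 1

/-- Pair-freezing helper `rel_eq_relB` (lens-4 g4 machinery; see the enclosing section docstring). -/
theorem rel_eq_relB (c : ℕ) (u : Fin n → Bool) : π.rel c tab u = π.relB tab ((c + π.o + 1 + wt u) % 3) u := by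
  unfold rel relB kappa
  refine Finset.filter_congr fun i _ => ?_
  have h : (c + (π.o + 2 * i.val + 1) + wt u + wtPrefix u (π.o + 2 * i.val)) % 3 =
      ((c + π.o + 1 + wt u) % 3 + 2 * i.val + wtPrefix u (π.o + 2 * i.val)) % 3 := by omega
  rw [h]

/-- relevance of pair `i` for residue `b` only depends on the coordinates below `o + 2i + 2`. -/
theorem mem_relB_congr (b : ℕ) {u u' : Fin n → Bool} (i : Fin π.P)
    (h : ∀ j : Fin n, j.val < π.o + 2 * i.val + 2 → u' j = u j) : i ∈ π.relB tab b u' ↔ i ∈ π.relB tab b u := by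
  have hP := π.le
  unfold relB
  rw [mem_filter, mem_filter]
  have h1 : u' (π.fst i) = u (π.fst i) := h _ (by simp)
  have h2 : u' (π.snd i) = u (π.snd i) := h _ (by simp)
  have h3 : wtPrefix u' (π.o + 2 * i.val) = wtPrefix u (π.o + 2 * i.val) :=
    wtPrefix_congr u u' 0 _ (Nat.zero_le _) (by omega) (by rw [wtPrefix_zero, wtPrefix_zero])
      fun j _ hj => h j (by omega)
  rw [h1, h2, h3]

/-- the special pairs: those whose middle cut the table fires. -/
def spec : Finset (Fin π.P) := univ.filter fun i => tab (π.mid i) = true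

/-- number of special pairs. -/
def t : ℕ := (π.spec tab).card

/-- increasing enumeration of the special pairs. -/
def sp : Fin (π.t tab) ↪o Fin π.P := (π.spec tab).orderEmbOfFin rfl

/-- Pair-freezing helper `sp_mem` (lens-4 g4 machinery; see the enclosing section docstring). -/
theorem sp_mem (k : Fin (π.t tab)) : tab (π.mid (π.sp tab k)) = true := by
  have h : π.sp tab k ∈ π.spec tab := Finset.orderEmbOfFin_mem _ _ k
  unfold spec at h
  rw [mem_filter] at h
  exact h.2

/-- number of couples of consecutive special pairs. -/
def K : ℕ := π.t tab / 2

/-- first pair of couple `j`. -/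
def ca (j : Fin (π.K tab)) : Fin π.P :=
  π.sp tab ⟨2 * j.val, by have := j.isLt; unfold K at this; omega⟩

/-- second pair of couple `j`. -/
def cd (j : Fin (π.K tab)) : Fin π.P :=
  π.sp tab ⟨2 * j.val + 1, by have := j.isLt; unfold K at this; omega⟩

/-- Pair-freezing helper `ca_mem` (lens-4 g4 machinery; see the enclosing section docstring). -/
theorem ca_mem (j : Fin (π.K tab)) : tab (π.mid (π.ca tab j)) = true := π.sp_mem tab _
/-- Pair-freezing helper `cd_mem` (lens-4 g4 machinery; see the enclosing section docstring). -/
theorem cd_mem (j : Fin (π.K tab)) : tab (π.mid (π.cd tab j)) = true := π.sp_mem tab _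

/-- Pair-freezing helper `ca_lt_cd` (lens-4 g4 machinery; see the enclosing section docstring). -/
theorem ca_lt_cd (j : Fin (π.K tab)) : π.ca tab j < π.cd tab j := by
  unfold ca cd
  exact (π.sp tab).strictMono (by simp)

/-- Pair-freezing helper `cd_lt_ca` (lens-4 g4 machinery; see the enclosing section docstring). -/
theorem cd_lt_ca {j j' : Fin (π.K tab)} (h : j.val < j'.val) : π.cd tab j < π.ca tab j' := by
  unfold ca cd
  exact (π.sp tab).strictMono (by simp; omega)

/-- Pair-freezing helper `ca_val_lt_cd` (lens-4 g4 machinery; see the enclosing section docstring). -/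
theorem ca_val_lt_cd (j : Fin (π.K tab)) : (π.ca tab j).val < (π.cd tab j).val := π.ca_lt_cd tab j

/-- couple `j` is good at `u` (for residue `b`): one of its two pairs is relevant. -/
def goodB (b : ℕ) (u : Fin n → Bool) (j : Fin (π.K tab)) : Bool :=
  decide (π.ca tab j ∈ π.relB tab b u) || decide (π.cd tab j ∈ π.relB tab b u)

/-- number of good couples. -/
def Nb (b : ℕ) (u : Fin n → Bool) : ℕ := (univ.filter fun j : Fin (π.K tab) => π.goodB tab b u j = true).card

/-- good couples inject into relevant pairs. -/
theorem Nb_le_card_relB (b : ℕ) (u : Fin n → Bool) : π.Nb tab b u ≤ (π.relB tab b u).card := by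
  unfold Nb
  refine Finset.card_le_card_of_injOn
    (fun j => if π.ca tab j ∈ π.relB tab b u then π.ca tab j else π.cd tab j) (fun j hj => ?_) ?_
  · rw [mem_coe, mem_filter] at hj
    have h := hj.2
    unfold goodB at h
    rw [Bool.or_eq_true, decide_eq_true_eq, decide_eq_true_eq] at h
    rw [mem_coe]
    dsimp only
    split_ifs with h1
    · exact h1
    · exact h.resolve_left h1
  · intro j _ j' _ hjj
    have hinj := (π.sp tab).injective
    have key : ∀ x y : Fin (π.t tab), π.sp tab x = π.sp tab y → x.val = y.val :=
      fun x y hxy => congrArg Fin.val (hinj hxy)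
    apply Fin.ext
    unfold ca cd at hjj
    simp only at hjj
    split_ifs at hjj with h1 h2 h2 <;> have hk := key _ _ hjj <;> simp only at hk <;> omega

/-- the couple potential `ψ_j ∈ {1, 2}`. -/
def psi (b : ℕ) (u : Fin n → Bool) (j : Fin (π.K tab)) : ℕ := if π.goodB tab b u j = true then 1 else 2

/-- the cumulative potential over the first `k` couples. -/
def Psi (b : ℕ) (u : Fin n → Bool) (k : ℕ) : ℕ :=
  ∏ j ∈ (univ.filter fun j : Fin (π.K tab) => j.val < k), π.psi tab b u j

/-- Pair-freezing helper `Psi_zero` (lens-4 g4 machinery; see the enclosing section docstring). -/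
theorem Psi_zero (b : ℕ) (u : Fin n → Bool) : π.Psi tab b u 0 = 1 := by
  unfold Psi
  rw [Finset.filter_false_of_mem fun j _ => Nat.not_lt_zero _, prod_empty]

/-- Pair-freezing helper `Psi_succ` (lens-4 g4 machinery; see the enclosing section docstring). -/
theorem Psi_succ (b : ℕ) (u : Fin n → Bool) {k : ℕ} (hk : k < π.K tab) :
    π.Psi tab b u (k + 1) = π.Psi tab b u k * π.psi tab b u ⟨k, hk⟩ := by
  unfold Psi
  have : (univ.filter fun j : Fin (π.K tab) => j.val < k + 1) =
      insert ⟨k, hk⟩ (univ.filter fun j : Fin (π.K tab) => j.val < k) := by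
    ext j
    simp only [mem_filter, mem_univ, true_and, mem_insert, Fin.ext_iff]
    omega
  rw [this, prod_insert, mul_comm]
  simp

/-- `Ψ_K · 2^{N} = 2^K`: the full potential is `2^{#bad couples}`. -/
theorem Psi_full_mul (b : ℕ) (u : Fin n → Bool) : π.Psi tab b u (π.K tab) * 2 ^ π.Nb tab b u = 2 ^ π.K tab := by
  unfold Psi Nb psi
  rw [Finset.filter_true_of_mem fun j _ => j.isLt, prod_ite, prod_const_one, one_mul, prod_const, ← pow_add]
  congr 1
  have h := Finset.card_filter_add_card_filter_not (s := (univ : Finset (Fin (π.K tab))))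
    (p := fun j => π.goodB tab b u j = true)
  rw [card_univ, Fintype.card_fin] at h
  omega

end Occupation
end Pairing
end Summit.QuantumAdvantage.QuantumAdvantage.Theorems.PairFreezing
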